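import Literature.AnabelianGeometry.EtaleTheta.ConstantMultipleDivisors
import Mathlib.CategoryTheory.SingleObj
import Mathlib.CategoryTheory.Types.Basic
import Mathlib.Logic.Equiv.Bool
import Mathlib.GroupTheory.Index
import Mathlib.SetTheory.Cardinal.Finite
import Mathlib.Topology.Algebra.Group.Basic

/-!
# [EtTh] Remarks 5.12.2 and 5.12.5 (iii) AS TYPED: the two named conditions are SCHEMATA —
# universal closures refuted in the kernel; instance forms

Mochizuki, *The étale theta function and its Frobenioid-theoretic manifestations*, Publ. RIMS **45**
(2009), §5, Remark 5.12.2 p.342 (PDF p.116) and Remark 5.12.5 (iii) p.345 (PDF p.119)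
[cite: MochizukiEtTh2009, Rmk 5.12.2 p.342; Rmk 5.12.5 (iii) p.345].

abc-iut cell, block F (fact-proving wave), seat abc-iut-f-111, tranche 111: FACT-LIST rows F-0499
`AutActsTrivially` and F-0500 `AutExtensionExact` (both `kernel_closedness = parametrised`, declared by
abc-iut-L2-t4 in `ConstantMultipleIndeterminacy.lean`).  PROOF-ONLY companion (no definition, no instance,
no named fact).  The two declarations are CONDITIONS on their parameters, not closed facts:

* `AutActsTrivially Dat E` ("that `Aut_E(E)` act as the identity on `D_E`", Rmk 5.12.2 — print states it
  as "one necessary condition for the data … to form a coherent system", i.e. a REQUIREMENT on data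
  `E ↦ D_E`, not a theorem).  Its universal closure is FALSE: `not_forall_autActsTrivially` (witness: the
  identity functor of `Type` and the non-trivial automorphism `not` of `Bool`).  Instance forms that DO
  hold: objects with trivial automorphism group (`autActsTrivially_of_aut_eq_one`) and constant data
  (`autActsTrivially_const`).
* `AutExtensionExact 𝔉 S` (exactness of `1 → O^×(S) → Aut_C(S) → Aut_D(S^bs) → 1`, Rmk 5.12.5 (iii) —
  print: "for objects `(−)`, such as `B_{N'}`, `B_N`, which are Aut-ample").  abc-iut-w5-d238 proved
  `ThetaFrobenioid.autExtensionExact_iff_isAutAmple` (it IS Aut-ampleness of `S`, [FrdI] Def. 1.2 (iv))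
  and the instance form print names, `autExtensionExact_BN_of_autAmpleBN` / `…_of_sgpCapSection`
  (`ConstantMultipleDivisors.lean`; cited, not re-proved).  Its universal closure — "EVERY object of EVERY
  §5 datum is Aut-ample" — is FALSE: `not_forall_autExtensionExact`, at an explicit closed inhabitant of
  the (data-only) interface `ThetaFrobenioid` over the one-object discrete category `C` lying over the
  one-object groupoid `D = B(ℤ/2)` via the constant functor (all [FrdI] operations trivial,
  `Π^tp_X := ℤ × ℤ/2 ↠ ℤ`, `Π^tp_Ÿ := 1`, `ρ := pr₂`): the object of `C` has trivial `Aut_C`, while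
  `Aut_D(S^bs) = ℤ/2`.  (A degenerate inhabitant, built only to certify the typed schema; it is not the
  tempered Frobenioid of a curve.)

So both rows are admissible only AT NAMED INSTANCES (as hypotheses/conclusions), never as closed binders.
HONEST FRAMING: [EtTh] is a published, refereed paper; a refuted universal closure of a typed PREDICATE says
nothing about the printed remarks; no side is taken on [IUTchIII] Cor. 3.12; typed ≠ proved.
-/

namespace Literature.AnabelianGeometry.EtaleTheta

open CategoryTheory

universe w₁ v u

/-! ### Remark 5.12.2: `AutActsTrivially` -/

/-- **Instance form of Rmk 5.12.2's condition**: if `Aut_E(E)` is trivial, it acts as the identity on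
any data `D_E`. [cite: MochizukiEtTh2009, Rmk 5.12.2 p.342 (PDF p.116)] -/
theorem autActsTrivially_of_aut_eq_one {C : Type u} [Category.{v} C] (Dat : C ⥤ Type w₁) (E : C)
    (h : ∀ α : Aut E, α = 1) : AutActsTrivially Dat E := by
  intro α
  rw [h α]
  exact Dat.map_id E

/-- **Instance form of Rmk 5.12.2's condition**: constant data `E ↦ X` are acted on trivially by every
`Aut_E(E)`. [cite: MochizukiEtTh2009, Rmk 5.12.2 p.342 (PDF p.116)] -/
theorem autActsTrivially_const {C : Type u} [Category.{v} C] (X : Type w₁) (E : C) :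
    AutActsTrivially ((Functor.const C).obj X) E :=
  fun _ => rfl

/-- **Rmk 5.12.2's condition is a schema, not a fact: its universal closure is FALSE** — the identity
functor `Type ⥤ Type` as data and the automorphism `not` of `Bool` (which is not the identity).
FACT-LIST row F-0499 (abc-iut-f-111): admissible per NAMED instance only.
[cite: MochizukiEtTh2009, Rmk 5.12.2 p.342 (PDF p.116)] -/
theorem not_forall_autActsTrivially :
    ¬ ∀ (C : Type 1) [Category.{0} C] (Dat : C ⥤ Type) (E : C), AutActsTrivially Dat E := by
  intro h
  have h1 := h Type (𝟭 Type) Bool (Equiv.toIso Equiv.boolNot)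
  have h2 := CategoryTheory.types_congr_hom h1 true
  simp at h2
  exact absurd h2 (by decide)

/-! ### Remark 5.12.5 (iii): `AutExtensionExact` -/

/-- **Rmk 5.12.5 (iii)'s exactness is a schema, not a fact: its universal closure ("every object of
every §5 datum is Aut-ample", cf. `ThetaFrobenioid.autExtensionExact_iff_isAutAmple`) is FALSE** — at the
degenerate closed inhabitant of the data-only interface `ThetaFrobenioid` described in the module
docstring (`C` = one object with trivial automorphisms over `D = B(ℤ/2)` via the constant functor), the
unique object `S` has `Aut_C(S) = 1 → Aut_D(S^bs) = ℤ/2` not surjective.  FACT-LIST row F-0500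
(abc-iut-f-111): admissible per NAMED instance only (in print: the Aut-ample objects `B_N`, `B_{N'}`;
in the tree: `autExtensionExact_BN_of_autAmpleBN`).
[cite: MochizukiEtTh2009, Rmk 5.12.5 (iii) p.345 (PDF p.119)] -/
theorem not_forall_autExtensionExact :
    ¬ ∀ (C : Type) [Category.{0} C] (D : Type) [Category.{0} D] (𝔉 : ThetaFrobenioid.{0} C D) (S : C),
      AutExtensionExact 𝔉 S := by
  intro h
  let G : Type := Multiplicative (ZMod 2)
  let P : Type := Multiplicative ℤ × G
  letI : TopologicalSpace P := ⊥
  haveI : DiscreteTopology P := ⟨rfl⟩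
  have hautC : ∀ (S : Discrete PUnit.{1}) (a : Aut S), a = 1 := fun S a => Iso.ext (Subsingleton.elim _ _)
  let pre : Literature.AlgebraicGeometry.Frobenioids.PreFrobenioidData.{0} (Discrete PUnit.{1}) (SingleObj G) :=
    { base := (Functor.const _).obj (SingleObj.star G)
      Mon := fun _ => PUnit
      pull := fun _ => MonoidHom.id _
      pull_id := fun _ _ => rfl
      pull_comp := fun _ _ _ => rfl
      div := fun _ => PUnit.unit
      degFr := fun _ => 1
      div_id := fun _ => rfl
      div_comp := fun _ _ => rfl
      degFr_id := fun _ => rfl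
      degFr_comp := fun _ _ => (one_mul _).symm }
  let 𝔉 : ThetaFrobenioid.{0} (Discrete PUnit.{1}) (SingleObj G) :=
    { pre := pre
      units_comm := fun S => ⟨⟨fun a b => Subtype.ext ((hautC S _).trans (hautC S _).symm)⟩⟩
      biratUnits := fun _ => ℚˣ
      unitsToBirat := fun _ => 1
      unitsToBirat_injective := fun S a b _ => Subtype.ext ((hautC S _).trans (hautC S _).symm)
      unitsPull := fun _ => 1
      IsBaseFrobeniusType := fun _ _ _ => True
      lDelta := fun _ => PUnit
      lDeltaMap := fun _ => 1
      l := 1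
      odd_l := odd_one
      N := 1
      Acirc := ⟨PUnit.unit⟩
      AN := ⟨PUnit.unit⟩
      BN := ⟨PUnit.unit⟩
      sCap := 𝟙 _
      sCup := 𝟙 _
      base_map_sCap := rfl
      isPreStep_sCap := ⟨rfl, (inferInstance : IsIso (𝟙 (SingleObj.star G)))⟩
      isPreStep_sCup := ⟨rfl, (inferInstance : IsIso (𝟙 (SingleObj.star G)))⟩
      PiX := P
      zquot := MonoidHom.fst _ _
      zquot_surjective := fun x => ⟨(x, 1), rfl⟩
      PiYdd := ⊥
      PiYdd_le := bot_le
      relindex_PiYdd := by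
        rw [Subgroup.relIndex_bot_left, MonoidHom.ker_fst,
          Nat.card_congr (Subgroup.prodEquiv (⊥ : Subgroup (Multiplicative ℤ)) (⊤ : Subgroup G)).toEquiv,
          Nat.card_prod, Subgroup.card_bot, Subgroup.card_top, one_mul,
          Nat.card_congr (Multiplicative.toAdd : G ≃ ZMod 2), Nat.card_zmod]
      PiYdd_normal := inferInstance
      isOpen_PiYdd := isOpen_discrete _
      ρ := (Units.toAut G).toMonoidHom.comp (toUnits.toMonoidHom.comp (MonoidHom.snd _ _))
      ρ_surjective := (Units.toAut G).surjective.comp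
        ((toUnits (G := G)).surjective.comp fun g => ⟨(1, g), rfl⟩)
      isOpen_ker_ρ := isOpen_discrete _
      strv := 1
      sgpCap := 1
      sgpCup := 1
      K := ℚ
      constEmb := MonoidHom.id _
      constEmb_injective := fun _ _ e => e
      thetaFn := 1 }
  obtain ⟨a, ha⟩ := (h _ _ 𝔉 ⟨PUnit.unit⟩).2 (Units.toAut G (toUnits (Multiplicative.ofAdd 1)))
  have h1 : 𝔉.autBase ⟨PUnit.unit⟩ a = 1 := Iso.ext rfl
  rw [h1] at ha
  have h2 := (Units.toAut G).injective (((Units.toAut G).map_one).trans ha)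
  have h3 := (toUnits (G := G)).injective ((map_one _).trans h2)
  exact absurd h3 (by decide)

end Literature.AnabelianGeometry.EtaleTheta
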